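import Summits.HodgeConjecture.HodgeConjecture.Theorems.Ring2AbelianAllWeilCellsAnchorPointed
import Summits.HodgeConjecture.HodgeConjecture.Theorems.Ring2HypothesesWeilComponentsLadder
import HarnessLib

/-!
# Ring 2 · AbelianAll (ab-weil-1, gen 10, part 8d) — CLOSED `∀`-forms of the anchor-pointed leaf N73 and the
  closed `Σ`-rows they feed

research route, not a corollary; conditional on HC_CM plus one named minimal statement.
Cell line: research route conditional on HC_CM; not a corollary; Q11.4-sentence-2 already refuted in dim ≥ 3.
`HC_CM` (`Theses.RankFourFaces.CMAbelianHodge`) does not occur in this file and no open case of the Hodge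
conjecture is claimed.

LEAD L22.3 (ii) (2026-08-20): the census instruments probe only CLOSED propositions (`C → S` needs a closed
`Prop`), while the Weil-column node of record N73 = `IsogenyConnectedToCMAnchor n d δ` (part 7,
`Ring2AbelianAllWeilCellsAnchorPointed`) is parameterised by the cell `(n, d, δ)`.  This file types the two closed
`∀`-forms the census asked for and nothing else: NO new moduli statement is minted — both are literally `∀`-closures
of N73 over an explicit index set — and no variational statement is minted (the closed variational input used in
§2 is the tree's existing R∞var `WeilTypeLadder.WeilVariationalHodgeQuadratic`, by name).

## What is typed / proved (0 sorry)

* §1 `IsogenyConnectedToCMAnchorAllCells` := `∀ n ≥ 1, ∀ d ≥ 1, ∀ δ, N73(n, d, δ)` (every meaningful cell; the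
  wrong-sign cells inside it are THEOREMS, part 7 `isogenyConnectedToCMAnchor_of_weilSign_ne`) and
  `IsogenyConnectedToCMAnchorFourfoldCells` := N73 on exactly the index set of the dimension-`≤ 5` floor rows
  (positive non-split squarefree fourfold cells `(2, d, δ)`, `d ∉ {1, 3}` squarefree, `δ ≠ [1]`, `sign δ = +1`);
  `…FourfoldCells_of_allCells`; the closed N72 ⟹ closed N73 edge
  (`isogenyConnectedToCMAnchorAllCells_of_forall_isogenyConnected`).
* §2 CLOSED ROWS (every hypothesis a closed proposition or a refereed named fact used BY NAME):
  `hodgeConjectureFor_abelian_dim_le_five_of_refereed_of_anchorPointedFourfoldCells_of_variationalQuadratic` —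
  `HC` for every complex abelian variety of dimension `≤ 5` from Moonen–Zarhin 1999, Koike 2004, Schoen 1998,
  Markman 2023, `IsogenyConnectedToCMAnchorFourfoldCells` and R∞var; and the column
  `weilClassesByComponent_of_anchorPointedAllCells_of_variationalQuadratic`.  R∞var is STRONGER than the per-cell
  variational instances the parameterised rows of part 7 consume (`…_variational_L`); the parameterised rows remain
  the sharper statement, these closed rows exist for the census.

What is NOT proved or claimed: N73 on any right-sign non-split cell, any variational instance, `HC` for any abelian
variety not already covered in the tree.  No Literature fact is introduced; no internally-minted statement is cited
as a fact.

## References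

* [vanGeemen1994HodgeAV] B. van Geemen, LNM 1594 (1994), Lemma 5.2, 5.3, 5.8–5.11.
* [Deligne1982HodgeCycles] P. Deligne, LNM 900, §4, proof of Thm. 4.8.
* [MoonenZarhin1999] B. Moonen, Yu. Zarhin, Duke Math. J. 97 (1999), Thm. 0.1.
* [CharlesSchnell2014Notes] F. Charles, C. Schnell, Notes on absolute Hodge classes, Conj. 11.3.1.
-/

noncomputable section

set_option linter.dupNamespace false

open CategoryTheory
open Literature.AlgebraicGeometry Literature.AlgebraicGeometry.Motives
open Literature.AlgebraicGeometry.HodgeTheory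
open Literature.AlgebraicGeometry.VanGeemen1994
open Literature.AlgebraicTopology.SingularHomology
open Summit.HodgeConjecture.HodgeConjecture.Ring2.Hypotheses
open Summit.HodgeConjecture.HodgeConjecture.WeilTypeLadder (WeilVariationalHodgeQuadratic)

namespace Summit.HodgeConjecture.HodgeConjecture.Ring2.AbelianAll

/-! ### §1 The closed `∀`-forms of N73 -/

/-- **N73, CLOSED over every meaningful cell**: for every `n ≥ 1`, `d ≥ 1` and every class `δ ∈ ℚ^×/Nm(K_d^×)` the
anchor-pointed leaf `IsogenyConnectedToCMAnchor n d δ` (the `(ℚ(√-d), 2n, δ)`-component of Weil's moduli space,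
as a pointed family supply, reaches the CM tower).  The wrong-sign cells are vacuous theorems (part 7); the split and
the closed-in-print cells are where the parameterised node is met in print (Deligne, proof of Thm. 4.8, for
`δ = [(-1)ⁿ]`).  Typed missing input, OPEN formally. [cite: vanGeemen1994HodgeAV, 5.3 and 5.8–5.11]
[cite: Deligne1982HodgeCycles, §4, proof of Thm. 4.8 (a)–(c)] [status: open] -/
@[conjecture] def IsogenyConnectedToCMAnchorAllCells : Prop :=
  ∀ n : ℕ, 0 < n → ∀ d : ℕ, 0 < d → ∀ δ : weilNormResidueGroup d, IsogenyConnectedToCMAnchor n d δ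

/-- **N73, CLOSED over the positive non-split squarefree FOURFOLD cells** — exactly the index set of the
dimension-`≤ 5` floor rows of part 7 (`d ≥ 1` squarefree, `d ∉ {1, 3}`, `δ ≠ [1]`, `sign δ = +1`). Typed missing
input, OPEN formally. [cite: vanGeemen1994HodgeAV, (5.4.1), 5.3 and 5.8–5.11] [status: open] -/
@[conjecture] def IsogenyConnectedToCMAnchorFourfoldCells : Prop :=
  ∀ d : ℕ, 0 < d → Squarefree d → d ≠ 1 → d ≠ 3 → ∀ δ : weilNormResidueGroup d,
    δ ≠ splitDiscriminantClass 2 d → weilSign d δ = 1 → IsogenyConnectedToCMAnchor 2 d δ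

/-- The fourfold form is a restriction of the all-cells form. [folklore] -/
theorem isogenyConnectedToCMAnchorFourfoldCells_of_allCells (h : IsogenyConnectedToCMAnchorAllCells) :
    IsogenyConnectedToCMAnchorFourfoldCells :=
  fun d hd _ _ _ δ _ _ => h 2 two_pos d hd δ

/-- **Closed N72 ⟹ closed N73** (part 7's `isogenyConnectedToCMAnchor_of_isogenyConnected`, cell by cell).
[cite: vanGeemen1994HodgeAV, 4.11, 4.14 and 5.3] -/
theorem isogenyConnectedToCMAnchorAllCells_of_forall_isogenyConnected
    (h : ∀ n : ℕ, 0 < n → ∀ d : ℕ, 0 < d → ∀ δ : weilNormResidueGroup d, IsogenyConnectedWeilComponent n d δ) :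
    IsogenyConnectedToCMAnchorAllCells :=
  fun n hn d hd δ => isogenyConnectedToCMAnchor_of_isogenyConnected hn hd (h n hn d hd δ)

/-! ### §2 The closed rows -/

/-- **CLOSED `Σ`-row: `HC` for every complex abelian variety of dimension `≤ 5`** from the four refereed print facts
of the floor (Moonen–Zarhin 1999, Koike 2004, Schoen 1998, Markman 2023 — used BY NAME), the closed fourfold form of
N73 and R∞var (`WeilTypeLadder.WeilVariationalHodgeQuadratic`, which supplies every per-cell variational instance by
`Hypotheses.weilVariationalHodgeComponent_of_weilVariationalHodgeQuadratic`).  No `HC_CM`.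
[cite: MoonenZarhin1999, Thm. 0.1] [cite: vanGeemen1994HodgeAV, (5.4.1), 5.3, 5.8–5.11]
[cite: CharlesSchnell2014Notes, Conj. 11.3.1] -/
theorem hodgeConjectureFor_abelian_dim_le_five_of_refereed_of_anchorPointedFourfoldCells_of_variationalQuadratic
    (hred : MoonenZarhin1999_hodgeClasses_abelian_dim_le_five_of_weilClassesFourfolds)
    (hK : Koike2004_weilClasses_algebraic_hyperbolicSixfold_one)
    (hS : Schoen1998_weilClasses_algebraic_hyperbolicSixfold_three)
    (hM23 : Markman2023_weilClasses_algebraic_discOneWeilFourfold)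
    (hN : IsogenyConnectedToCMAnchorFourfoldCells) (hV : WeilVariationalHodgeQuadratic)
    (A : AbelianVariety ℂ) (hA : A.dim ≤ 5) : HodgeConjectureFor A.dim A.X :=
  hodgeConjectureFor_abelian_dim_le_five_of_refereed_anchorPointed_variational_L hred hK hS hM23
    (fun d hd hsq h1 h3 δ hns hδ =>
      ⟨hN d hd hsq h1 h3 δ hns hδ, weilVariationalHodgeComponent_of_weilVariationalHodgeQuadratic hV le_rfl hd δ⟩)
    A hA

/-- **CLOSED `Σ`-row with the all-cells form** (weaker row, same conclusion). [cite: MoonenZarhin1999, Thm. 0.1]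
[cite: vanGeemen1994HodgeAV, 5.3, 5.8–5.11] [cite: CharlesSchnell2014Notes, Conj. 11.3.1] -/
theorem hodgeConjectureFor_abelian_dim_le_five_of_refereed_of_anchorPointedAllCells_of_variationalQuadratic
    (hred : MoonenZarhin1999_hodgeClasses_abelian_dim_le_five_of_weilClassesFourfolds)
    (hK : Koike2004_weilClasses_algebraic_hyperbolicSixfold_one)
    (hS : Schoen1998_weilClasses_algebraic_hyperbolicSixfold_three)
    (hM23 : Markman2023_weilClasses_algebraic_discOneWeilFourfold)
    (hN : IsogenyConnectedToCMAnchorAllCells) (hV : WeilVariationalHodgeQuadratic)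
    (A : AbelianVariety ℂ) (hA : A.dim ≤ 5) : HodgeConjectureFor A.dim A.X :=
  hodgeConjectureFor_abelian_dim_le_five_of_refereed_of_anchorPointedFourfoldCells_of_variationalQuadratic hred hK
    hS hM23 (isogenyConnectedToCMAnchorFourfoldCells_of_allCells hN) hV A hA

/-- **CLOSED column: `WeilClassesByComponent`** (every component, every `n ≥ 2`, `d ≥ 1`, `δ`) from the all-cells
form of N73 and R∞var. [cite: vanGeemen1994HodgeAV, Lemma 5.2 (4), 5.3–5.5] [cite: CharlesSchnell2014Notes, Conj. 11.3.1] -/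
theorem weilClassesByComponent_of_anchorPointedAllCells_of_variationalQuadratic
    (hN : IsogenyConnectedToCMAnchorAllCells) (hV : WeilVariationalHodgeQuadratic) : WeilClassesByComponent :=
  weilClassesByComponent_of_forall_anchorPointed_and_variational fun n hn d hd δ =>
    ⟨hN n (by omega) d hd δ, weilVariationalHodgeComponent_of_weilVariationalHodgeQuadratic hV hn hd δ⟩

end Summit.HodgeConjecture.HodgeConjecture.Ring2.AbelianAll

end
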